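import Mathlib
import HarnessLib
import Summits.HubbardSuperconductivity.HubbardSuperconductivity.Theorems.KLProgrammeC4aPathComparability
import Summits.HubbardSuperconductivity.HubbardSuperconductivity.Theorems.KLProgrammeC4aPathRigidity
import Summits.HubbardSuperconductivity.HubbardSuperconductivity.Theorems.KLProgrammeC4aJacobianFrameJets

/-!
# Route `KLProgramme` — crux C4a, value layer (L3-val): the chart GEOMETRY behind the signed (principal-value) pairing of an EVEN
# pair-momentum vertex across the Cooper angle — radial velocity of the co-moving chart, its angular modulus, the reflection defect
# `S_{σ,π+φ,θ}(0) + S_{σ,π−φ,θ}(0)` and the distance of the reflection segment from the Cooper point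

Cell `gate-hubbard-kl`, lane hubbard-kl-k3c3-p3 (g14, Jacobian-certificate / value-row lineage: `…C4aLevelDensityRadial*` p573650/p574511/p575577);
helper for stub (C) `stub_twoLeg_curvature` of the engine-flow child `KLRegimeEngineV17F2` (stmt-HubbardSuperconductivity-20437), `k = 0` VALUE clause
(located risk #12 «(C)-VALUE-K0»; the (L3-val) input (ii) of HOME/hubbard-kl-c4a-1/C4A-PLAN.md §20.3 / §22.3).

WHY.  The value theorem pairs the tube tadpole at levels `±ρ`; its datum is a dominator `d(ρ) = D·|ρ|` of the odd-difference of the angular averages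
`G_θ(ρ) − G_θ(−ρ)` (`…C4aTadpoleValueAssembly.norm_sum_tubeTadpoles_le_of_oddDiff`).  For a pair-momentum vertex `V(k,q) = B(k+q)`, `B` EVEN with Fréchet
majorants `‖DB(p)‖ ≲ max(c′‖p‖, Λ)⁻¹`, `‖D²B(p)‖ ≲ max(c′‖p‖, Λ)⁻²` (the scale-resolved bubbles), a pointwise dominator of `B(S_{ρ}) − B(S_{−ρ})` integrates to
`ρ·log(1/Λ)`; the `Λ`-free law needs the SIGN: write the difference as `∫_{−ρ}^{ρ} DB(S_σ)[∂_σS_σ] dσ` and pair the relative angles `π + φ ↔ π − φ` AT FIXED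
LEVEL `σ`; evenness of `B` turns `DB(S_{σ,π−φ})` into `−DB(S_{σ,π+φ} − Δ′_σ(φ))` with the REFLECTION DEFECT `Δ′_σ(φ) = S_{σ,π+φ,θ}(0) + S_{σ,π−φ,θ}(0)`
(size `|σ| + φ²`), leaving a second difference of `DB` across `Δ′` at distance `≳ |φ|` from the Cooper point (integrable, `Λ`-free) plus the oscillation
of the weight `J·∂_σS` across the centre (bounded).  This file is the geometry; the pairing and the assembly are `…C4aValueBridgePV` / `…C4aValueBridge`.

* §1 the RADIAL VELOCITY of the chart: `∂_ρ Φ(ρ,ϑ) = toLp(∂_μu_K(μ+ρ;ϑ) • dir ϑ)` (`hasDerivAt_levelPoint_level`), `∂_μu = J/u`, `0 < ∂_μu ≤ 1/(Dt_min − 2A)`,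
  and the velocity of the pair-sum path in the level (`hasDerivAt_pairSumPath_level`);
* §2 ANGULAR MODULI: `|J(ρ,s) − J(ρ,s′)| ≤ klJacG…1·|s−s′|`, `|u(s) − u(s′)| ≤ klJacR1·|s−s′|`, `|∂_μu(ρ,s) − ∂_μu(ρ,s′)| ≤ velLip·|s−s′|`, the chord bound
  `‖toLp(dir s) − toLp(dir s′)‖ ≤ |s − s′|`, and the velocity vector's modulus;
* §3 the REFLECTION DEFECT about the Cooper angle: `‖Φ(0,θ+φ) + Φ(0,θ−φ) − 2Φ(0,θ)‖ ≤ 2·msD₂·φ²`, `‖Δ′_ρ(φ)‖ ≤ 2|ρ|/(Dt_min−2A) + 2·msD₂·φ²`, and the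
  reflection SEGMENT stays away from the Cooper point: `pairSumLowerConst r·|φ| − 3|ρ|/(Dt_min−2A) − 2·msD₂·φ² ≤ ‖S_{ρ,π+φ,θ}(0) − t·Δ′_ρ(φ)‖` (`t ∈ [0,1]`).

Pure calculus on the tree's objects (`levelPoint`, `levelChartJac`, `pairSumPath`), keyed by the frame's sizes exactly as `…C4aPathJets` /
`…C4aPathComparability`; nothing about the Hubbard model's sizes; nothing asserts superconductivity.
References: BGM 2006 §2.4 Lemma 2.1 [cite: BenfattoGiulianiMastropietro2006]; FST II CPAM 51 (1998) §3 (the Cooper logarithm is integrable in the angle).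
-/

noncomputable section

namespace Summit.HubbardSuperconductivity.HubbardSuperconductivity.Theorems.C4a

set_option linter.dupNamespace false -- summit = problem name (single-conjunct summit), D-0017

open Real Set MeasureTheory Filter
open scoped ContDiff Topology
open Literature.MathematicalPhysics.QuantumLattice Literature.MathematicalPhysics.QuantumLattice.BandSectorCounting Literature.Probability.LatticeModels
open Summit.HubbardSuperconductivity.HubbardSuperconductivity.Theorems.KLRegimeSplit
open Summit.HubbardSuperconductivity.HubbardSuperconductivity.Theorems.DispersionFlow
open Summit.HubbardSuperconductivity.HubbardSuperconductivity.Theorems.PerturbedFermiCurve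

/-! ## §0 Two elementary facts about directions -/

/-- `‖toLp (dir s)‖ = 1` (Euclidean norm). -/
theorem norm_toLp_dir (s : ℝ) : ‖(WithLp.toLp 2 (dir s) : Momentum)‖ = 1 := by
  have h := norm_toLp_smul_dir 1 s
  rwa [one_smul, abs_one] at h

/-- **Chord ≤ arc**: `‖toLp (dir s) − toLp (dir s′)‖ ≤ |s − s′|` (mean value theorem; the direction map has a unit-speed derivative). -/
theorem norm_toLp_dir_sub_le (s s' : ℝ) : ‖(WithLp.toLp 2 (dir s) : Momentum) - WithLp.toLp 2 (dir s')‖ ≤ |s - s'| := by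
  set L : (Fin 2 → ℝ) →L[ℝ] Momentum := ((PiLp.continuousLinearEquiv 2 ℝ (fun _ : Fin 2 => ℝ)).symm : (Fin 2 → ℝ) →L[ℝ] Momentum) with hL
  have hLapp : ∀ v : Fin 2 → ℝ, L v = WithLp.toLp 2 v := fun v => rfl
  have hder : ∀ x : ℝ, HasDerivAt (fun t : ℝ => (WithLp.toLp 2 (dir t) : Momentum)) (WithLp.toLp 2 (dir (x + π / 2))) x := fun x => by
    have h := (L.hasFDerivAt).comp_hasDerivAt x (PerturbedFermiCurve.hasDerivAt_dir x)
    rw [show (fun t : ℝ => (WithLp.toLp 2 (dir t) : Momentum)) = (L : (Fin 2 → ℝ) → Momentum) ∘ dir from funext fun t => (hLapp _).symm,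
      ← hLapp]
    exact h
  have hdiff : Differentiable ℝ (fun t : ℝ => (WithLp.toLp 2 (dir t) : Momentum)) := fun x => (hder x).differentiableAt
  have hbound : ∀ x ∈ (univ : Set ℝ), ‖deriv (fun t : ℝ => (WithLp.toLp 2 (dir t) : Momentum)) x‖ ≤ 1 := fun x _ => by
    rw [(hder x).deriv, norm_toLp_dir]
  have h := (convex_univ (𝕜 := ℝ) (E := ℝ)).norm_image_sub_le_of_norm_deriv_le (fun x _ => hdiff x) hbound (mem_univ s') (mem_univ s)
  simpa using h

/-! ## §1 The radial velocity of the co-moving chart -/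

section Level

variable {a b : ℝ} (B : BandBounds a b) {K : TrigPolyC4v} {A : ℝ}
  (hA : ∀ p : Momentum, ∀ j ≤ 2, ‖iteratedFDeriv ℝ j (frameShift K) p‖ ≤ A) (hADt : 2 * A < B.Dtmin)
  {μ r : ℝ} (hlo : a < μ - r - A) (hhi : μ + r + A < b)
include B hA hADt hlo hhi

/-- **The level derivative of the radius exists along the tube**: `s ↦ u_K(μ+s; ϑ)` has derivative `∂_μu_K(μ+ρ; ϑ)` at every `|ρ| < r`. -/
theorem hasDerivAt_levelRadius_level {ρ : ℝ} (hρ : ρ ∈ Ioo (-r) r) (ϑ : ℝ) :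
    HasDerivAt (fun s : ℝ => perturbedFermiRadius (fun k : Fin 2 → ℝ => -K.eval k) (μ + s) ϑ)
      (deriv (fun m : ℝ => perturbedFermiRadius (fun k : Fin 2 → ℝ => -K.eval k) m ϑ) (μ + ρ)) ρ := by
  have hC : ContDiff ℝ ((⊤ : ℕ∞) : WithTop ℕ∞) (fun k : Fin 2 → ℝ => -K.eval k) := by
    rw [← frameShift_toLp_eq_neg_eval]; exact contDiff_frameShift_toLp K
  have hδ : ∀ k : Fin 2 → ℝ, (∀ i, |k i| ≤ π) → |(fun q : Fin 2 → ℝ => -K.eval q) k| ≤ A := fun k _ => by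
    simpa [frameShift_toLp] using abs_frameShift_toLp_le hA k
  have hκ : ∀ k : Fin 2 → ℝ, (∀ i, |k i| ≤ π) → ‖fderiv ℝ (fun q : Fin 2 → ℝ => -K.eval q) k‖ ≤ 2 * A := fun k _ => by
    rw [← frameShift_toLp_eq_neg_eval]; exact norm_fderiv_frameShift_toLp_le hA k
  have hD := hasDerivAt_perturbedFermiRadius_level B hC (by simp) hδ hκ hADt (μ₀ := μ + ρ) (by have := hρ.1; linarith) (by have := hρ.2; linarith) ϑ
  rw [hD.deriv]; exact HasDerivAt.comp_const_add μ ρ hD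

/-- **Bounds on the level derivative** along the tube: `0 < ∂_μu_K(μ+ρ; ϑ) ≤ 1/(Dt_min − 2A)`. -/
theorem deriv_levelRadius_level_pos_le {ρ : ℝ} (hρ : ρ ∈ Ioo (-r) r) (ϑ : ℝ) :
    0 < deriv (fun m : ℝ => perturbedFermiRadius (fun k : Fin 2 → ℝ => -K.eval k) m ϑ) (μ + ρ) ∧
      deriv (fun m : ℝ => perturbedFermiRadius (fun k : Fin 2 → ℝ => -K.eval k) m ϑ) (μ + ρ) ≤ (B.Dtmin - 2 * A)⁻¹ := by
  have hC : ContDiff ℝ ((⊤ : ℕ∞) : WithTop ℕ∞) (fun k : Fin 2 → ℝ => -K.eval k) := by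
    rw [← frameShift_toLp_eq_neg_eval]; exact contDiff_frameShift_toLp K
  have hδ : ∀ k : Fin 2 → ℝ, (∀ i, |k i| ≤ π) → |(fun q : Fin 2 → ℝ => -K.eval q) k| ≤ A := fun k _ => by
    simpa [frameShift_toLp] using abs_frameShift_toLp_le hA k
  have hκ : ∀ k : Fin 2 → ℝ, (∀ i, |k i| ≤ π) → ‖fderiv ℝ (fun q : Fin 2 → ℝ => -K.eval q) k‖ ≤ 2 * A := fun k _ => by
    rw [← frameShift_toLp_eq_neg_eval]; exact norm_fderiv_frameShift_toLp_le hA k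
  exact deriv_perturbedFermiRadius_level_pos_le B hC (by simp) hδ hκ hADt (μ₀ := μ + ρ) (by have := hρ.1; linarith) (by have := hρ.2; linarith) ϑ

omit hADt in
/-- **`∂_μu = J/u`** on the tube (the Jacobian weight is `u·∂_μu`, the radius is positive). -/
theorem deriv_levelRadius_level_eq_jac_div {ρ : ℝ} (hρ : ρ ∈ Ioo (-r) r) (ϑ : ℝ) :
    deriv (fun m : ℝ => perturbedFermiRadius (fun k : Fin 2 → ℝ => -K.eval k) m ϑ) (μ + ρ) =
      levelChartJac μ K (ρ, ϑ) / perturbedFermiRadius (fun k : Fin 2 → ℝ => -K.eval k) (μ + ρ) ϑ := by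
  have h1 : a ≤ μ + ρ - A := by have := hρ.1; linarith
  have h2 : μ + ρ + A ≤ b := by have := hρ.2; linarith
  have hu : 0 < perturbedFermiRadius (fun k : Fin 2 → ℝ => -K.eval k) (μ + ρ) ϑ := levelRadius_pos B hA h1 h2 ϑ
  rw [levelChartJac_apply, eq_div_iff hu.ne']
  ring

/-- **THE RADIAL VELOCITY OF THE CHART**: `s ↦ Φ(s, ϑ)` has derivative `toLp(∂_μu_K(μ+ρ;ϑ) • dir ϑ)` at every `|ρ| < r`. -/
theorem hasDerivAt_levelPoint_level {ρ : ℝ} (hρ : ρ ∈ Ioo (-r) r) (ϑ : ℝ) :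
    HasDerivAt (fun s : ℝ => levelPoint μ K s ϑ)
      (WithLp.toLp 2 (deriv (fun m : ℝ => perturbedFermiRadius (fun k : Fin 2 → ℝ => -K.eval k) m ϑ) (μ + ρ) • dir ϑ)) ρ := by
  set L : (Fin 2 → ℝ) →L[ℝ] Momentum := ((PiLp.continuousLinearEquiv 2 ℝ (fun _ : Fin 2 => ℝ)).symm : (Fin 2 → ℝ) →L[ℝ] Momentum) with hL
  have hLapp : ∀ v : Fin 2 → ℝ, L v = WithLp.toLp 2 v := fun v => rfl
  have h1 := (hasDerivAt_levelRadius_level B hA hADt hlo hhi hρ ϑ).smul_const (dir ϑ)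
  have h2 := (L.hasFDerivAt).comp_hasDerivAt ρ h1
  have hfun : (fun s : ℝ => levelPoint μ K s ϑ) =
      L ∘ fun s : ℝ => perturbedFermiRadius (fun k : Fin 2 → ℝ => -K.eval k) (μ + s) ϑ • dir ϑ := by
    funext s; simp only [Function.comp_apply, hLapp, levelPoint_eq_toLp_smul_dir]
  rw [hfun]
  simpa [hLapp] using h2

/-- The radial velocity has norm `∂_μu ≤ 1/(Dt_min − 2A)`. -/
theorem norm_levelVel_le {ρ : ℝ} (hρ : ρ ∈ Ioo (-r) r) (ϑ : ℝ) :
    ‖(WithLp.toLp 2 (deriv (fun m : ℝ => perturbedFermiRadius (fun k : Fin 2 → ℝ => -K.eval k) m ϑ) (μ + ρ) • dir ϑ) : Momentum)‖ ≤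
      (B.Dtmin - 2 * A)⁻¹ := by
  rw [norm_toLp_smul_dir]
  obtain ⟨h0, h1⟩ := deriv_levelRadius_level_pos_le B hA hADt hlo hhi hρ ϑ
  rwa [abs_of_pos h0]

/-- **Velocity of the pair-sum path in the level**: `σ ↦ S_{σ,ψ,θ}(0) = Φ(0,θ) + Φ(σ,ψ+θ)` has derivative `toLp(∂_μu_K(μ+σ;ψ+θ) • dir(ψ+θ))`. -/
theorem hasDerivAt_pairSumPath_level {σ : ℝ} (hσ : σ ∈ Ioo (-r) r) (ψ θ : ℝ) :
    HasDerivAt (fun s : ℝ => pairSumPath μ K s ψ θ 0)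
      (WithLp.toLp 2 (deriv (fun m : ℝ => perturbedFermiRadius (fun k : Fin 2 → ℝ => -K.eval k) m (ψ + θ)) (μ + σ) • dir (ψ + θ))) σ := by
  have h := (hasDerivAt_levelPoint_level B hA hADt hlo hhi hσ (ψ + θ)).const_add (levelPoint μ K 0 θ)
  refine h.congr_of_eventuallyEq (Eventually.of_forall fun s => ?_)
  simp only [pairSumPath_apply_zero]

/-- The pair-sum path is continuous in the level (on the tube). -/
theorem continuousOn_pairSumPath_level (ψ θ : ℝ) : ContinuousOn (fun s : ℝ => pairSumPath μ K s ψ θ 0) (Ioo (-r) r) := fun _ hσ =>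
  (hasDerivAt_pairSumPath_level B hA hADt hlo hhi hσ ψ θ).continuousAt.continuousWithinAt

/-! ## §2 Angular moduli of the Jacobian, of the radius and of the radial velocity -/

/-- The angular section `s ↦ J(ρ, s)` is differentiable (the Jacobian weight is `C^∞` on the open tube). -/
theorem differentiable_levelChartJac_angle {ρ : ℝ} (hρ : ρ ∈ Ioo (-r) r) : Differentiable ℝ fun s : ℝ => levelChartJac μ K (ρ, s) := by
  intro s
  have hT : IsOpen ({ρ : ℝ | |ρ| < r} ×ˢ (univ : Set ℝ)) := (isOpen_lt continuous_abs continuous_const).prod isOpen_univ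
  have hmem : (ρ, s) ∈ {ρ : ℝ | |ρ| < r} ×ˢ (univ : Set ℝ) := mk_mem_prod (abs_lt.2 ⟨hρ.1, hρ.2⟩) (mem_univ _)
  have hJ : ContDiffAt ℝ ∞ (levelChartJac μ K) (ρ, s) := (contDiffOn_levelChartJac B hA hADt hlo hhi).contDiffAt (hT.mem_nhds hmem)
  have hc : ContDiffAt ℝ ∞ (fun t : ℝ => ((ρ, t) : ℝ × ℝ)) s := (contDiff_const.prodMk contDiff_id).contDiffAt
  exact ((hJ.comp s hc).differentiableAt (by simp)).congr_of_eventuallyEq (Eventually.of_forall fun t => rfl)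

/-- **Angular modulus of the Jacobian**: `|J(ρ,s) − J(ρ,s′)| ≤ klJacG Dt_min A A₃ 1·|s − s′|` for `|ρ| < r` (any `A₃`: the order-1 entry does not read it). -/
theorem abs_levelChartJac_sub_le_angle {ρ : ℝ} (hρ : ρ ∈ Ioo (-r) r) (A₃ : ℝ) (s s' : ℝ) :
    |levelChartJac μ K (ρ, s) - levelChartJac μ K (ρ, s')| ≤ klJacG B.Dtmin A A₃ 1 * |s - s'| := by
  have h1 : a < μ + ρ - A := by have := hρ.1; linarith
  have h2 : μ + ρ + A < b := by have := hρ.2; linarith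
  have hdiff := differentiable_levelChartJac_angle B hA hADt hlo hhi hρ
  have hbound : ∀ x ∈ (univ : Set ℝ), ‖deriv (fun t : ℝ => levelChartJac μ K (ρ, t)) x‖ ≤ klJacG B.Dtmin A A₃ 1 := fun x _ => by
    rw [Real.norm_eq_abs]; exact abs_deriv_levelChartJac_le B hA hADt h1 h2 A₃ x
  have h := (convex_univ (𝕜 := ℝ) (E := ℝ)).norm_image_sub_le_of_norm_deriv_le (fun x _ => hdiff x) hbound (mem_univ s') (mem_univ s)
  rwa [Real.norm_eq_abs, Real.norm_eq_abs] at h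

/-- **Angular modulus of the radius**: `|u_K(μ+ρ;s) − u_K(μ+ρ;s′)| ≤ klJacR1 Dt_min A·|s − s′|` for `|ρ| < r`. -/
theorem abs_levelRadius_sub_le_angle {ρ : ℝ} (hρ : ρ ∈ Ioo (-r) r) (s s' : ℝ) :
    |perturbedFermiRadius (fun k : Fin 2 → ℝ => -K.eval k) (μ + ρ) s - perturbedFermiRadius (fun k : Fin 2 → ℝ => -K.eval k) (μ + ρ) s'| ≤
      klJacR1 B.Dtmin A * |s - s'| := by
  have h1 : a < μ + ρ - A := by have := hρ.1; linarith
  have h2 : μ + ρ + A < b := by have := hρ.2; linarith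
  obtain ⟨-, hu, -, -, -, -, hR₁, -⟩ := polar_data B hA hADt h1 h2
  have hdiff : Differentiable ℝ (perturbedFermiRadius (fun k : Fin 2 → ℝ => -K.eval k) (μ + ρ)) := hu.differentiable (by norm_num)
  have hbound : ∀ x ∈ (univ : Set ℝ), ‖deriv (perturbedFermiRadius (fun k : Fin 2 → ℝ => -K.eval k) (μ + ρ)) x‖ ≤ klJacR1 B.Dtmin A :=
    fun x _ => by rw [Real.norm_eq_abs]; exact hR₁ x
  have h := (convex_univ (𝕜 := ℝ) (E := ℝ)).norm_image_sub_le_of_norm_deriv_le (fun x _ => hdiff x) hbound (mem_univ s') (mem_univ s)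
  rwa [Real.norm_eq_abs, Real.norm_eq_abs] at h

/-- **Angular modulus of the radial velocity coefficient** (`∂_μu = J/u`, `u ≥ u_min`, `|J| ≤ π√2/(Dt_min − 2A)`):
`|∂_μu(ρ,s) − ∂_μu(ρ,s′)| ≤ (klJacG…1/u_min + (π√2/(Dt_min − 2A))·klJacR1/u_min²)·|s − s′|`. -/
theorem abs_deriv_levelRadius_level_sub_le_angle {ρ : ℝ} (hρ : ρ ∈ Ioo (-r) r) (A₃ : ℝ) (s s' : ℝ) :
    |deriv (fun m : ℝ => perturbedFermiRadius (fun k : Fin 2 → ℝ => -K.eval k) m s) (μ + ρ) -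
        deriv (fun m : ℝ => perturbedFermiRadius (fun k : Fin 2 → ℝ => -K.eval k) m s') (μ + ρ)| ≤
      (klJacG B.Dtmin A A₃ 1 / B.umin + π * Real.sqrt 2 / (B.Dtmin - 2 * A) * klJacR1 B.Dtmin A / B.umin ^ 2) * |s - s'| := by
  have h1 : a ≤ μ + ρ - A := by have := hρ.1; linarith
  have h2 : μ + ρ + A ≤ b := by have := hρ.2; linarith
  have h1' : a < μ + ρ - A := by have := hρ.1; linarith
  have h2' : μ + ρ + A < b := by have := hρ.2; linarith
  set u := perturbedFermiRadius (fun k : Fin 2 → ℝ => -K.eval k) (μ + ρ) s with hudef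
  set u' := perturbedFermiRadius (fun k : Fin 2 → ℝ => -K.eval k) (μ + ρ) s' with hu'def
  set J := levelChartJac μ K (ρ, s) with hJdef
  set J' := levelChartJac μ K (ρ, s') with hJ'def
  have humin : 0 < B.umin := B.umin_pos
  have hum : B.umin ≤ u := umin_le_frameRadius B hA h1 h2 s
  have hum' : B.umin ≤ u' := umin_le_frameRadius B hA h1 h2 s'
  have hu0 : 0 < u := humin.trans_le hum
  have hu0' : 0 < u' := humin.trans_le hum'
  have hJ'le : |J'| ≤ π * Real.sqrt 2 / (B.Dtmin - 2 * A) := by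
    rw [hJ'def, abs_of_pos (by rw [levelChartJac_apply]; exact levelChartJac_pos B hA hADt h1' h2'), levelChartJac_apply]
    exact levelChartJac_le B hA hADt h1' h2'
  have hJJ : |J - J'| ≤ klJacG B.Dtmin A A₃ 1 * |s - s'| := abs_levelChartJac_sub_le_angle B hA hADt hlo hhi hρ A₃ s s'
  have huu : |u - u'| ≤ klJacR1 B.Dtmin A * |s - s'| := abs_levelRadius_sub_le_angle B hA hADt hlo hhi hρ s s'
  rw [deriv_levelRadius_level_eq_jac_div B hA hlo hhi hρ s, deriv_levelRadius_level_eq_jac_div B hA hlo hhi hρ s']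
  -- `J/u − J′/u′ = (J − J′)/u + J′·(u′ − u)/(u·u′)`
  have hsplit : J / u - J' / u' = (J - J') / u + J' * (u' - u) / (u * u') := by
    field_simp
    ring
  rw [hsplit]
  have hG1 : 0 ≤ klJacG B.Dtmin A A₃ 1 := le_trans (abs_nonneg _) (by
    have := abs_deriv_levelChartJac_le B hA hADt h1' h2' A₃ s; exact this)
  have hR1 : 0 ≤ klJacR1 B.Dtmin A := le_trans (abs_nonneg _) (by
    obtain ⟨-, -, -, -, -, -, hR₁, -⟩ := polar_data B hA hADt h1' h2'; exact hR₁ s)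
  have hT1 : |(J - J') / u| ≤ klJacG B.Dtmin A A₃ 1 / B.umin * |s - s'| := by
    rw [abs_div, abs_of_pos hu0, div_mul_eq_mul_div]
    exact div_le_div₀ (by positivity) hJJ humin hum
  have hT2 : |J' * (u' - u) / (u * u')| ≤ π * Real.sqrt 2 / (B.Dtmin - 2 * A) * klJacR1 B.Dtmin A / B.umin ^ 2 * |s - s'| := by
    rw [abs_div, abs_mul, abs_of_pos (mul_pos hu0 hu0'), abs_sub_comm, div_mul_eq_mul_div]
    have hden : B.umin ^ 2 ≤ u * u' := by rw [sq]; exact mul_le_mul hum hum' humin.le hu0.le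
    have hDt : 0 < B.Dtmin - 2 * A := by linarith
    refine div_le_div₀ (by positivity) ?_ (by positivity) hden
    calc |J'| * |u - u'| ≤ π * Real.sqrt 2 / (B.Dtmin - 2 * A) * (klJacR1 B.Dtmin A * |s - s'|) :=
          mul_le_mul hJ'le huu (abs_nonneg _) (by positivity)
      _ = π * Real.sqrt 2 / (B.Dtmin - 2 * A) * klJacR1 B.Dtmin A * |s - s'| := by ring
  calc |(J - J') / u + J' * (u' - u) / (u * u')| ≤ |(J - J') / u| + |J' * (u' - u) / (u * u')| := abs_add_le _ _
    _ ≤ klJacG B.Dtmin A A₃ 1 / B.umin * |s - s'| + π * Real.sqrt 2 / (B.Dtmin - 2 * A) * klJacR1 B.Dtmin A / B.umin ^ 2 * |s - s'| :=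
        add_le_add hT1 hT2
    _ = _ := by ring

/-- **Angular modulus of the radial VELOCITY VECTOR**: with `velLip = klJacG…1/u_min + (π√2/(Dt_min−2A))·klJacR1/u_min²`,
`‖toLp(∂_μu(ρ,s)•dir s) − toLp(∂_μu(ρ,s′)•dir s′)‖ ≤ (velLip + 1/(Dt_min − 2A))·|s − s′|`. -/
theorem norm_levelVel_sub_le_angle {ρ : ℝ} (hρ : ρ ∈ Ioo (-r) r) (A₃ : ℝ) (s s' : ℝ) :
    ‖(WithLp.toLp 2 (deriv (fun m : ℝ => perturbedFermiRadius (fun k : Fin 2 → ℝ => -K.eval k) m s) (μ + ρ) • dir s) : Momentum) -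
        WithLp.toLp 2 (deriv (fun m : ℝ => perturbedFermiRadius (fun k : Fin 2 → ℝ => -K.eval k) m s') (μ + ρ) • dir s')‖ ≤
      (klJacG B.Dtmin A A₃ 1 / B.umin + π * Real.sqrt 2 / (B.Dtmin - 2 * A) * klJacR1 B.Dtmin A / B.umin ^ 2 + (B.Dtmin - 2 * A)⁻¹) *
        |s - s'| := by
  set v := deriv (fun m : ℝ => perturbedFermiRadius (fun k : Fin 2 → ℝ => -K.eval k) m s) (μ + ρ) with hvdef
  set v' := deriv (fun m : ℝ => perturbedFermiRadius (fun k : Fin 2 → ℝ => -K.eval k) m s') (μ + ρ) with hv'def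
  have hvv : |v - v'| ≤ (klJacG B.Dtmin A A₃ 1 / B.umin + π * Real.sqrt 2 / (B.Dtmin - 2 * A) * klJacR1 B.Dtmin A / B.umin ^ 2) * |s - s'| :=
    abs_deriv_levelRadius_level_sub_le_angle B hA hADt hlo hhi hρ A₃ s s'
  have hv'le : |v'| ≤ (B.Dtmin - 2 * A)⁻¹ := by
    obtain ⟨h0, h1⟩ := deriv_levelRadius_level_pos_le B hA hADt hlo hhi hρ s'
    rwa [hv'def, abs_of_pos h0]
  -- `v•d − v′•d′ = (v − v′)•d + v′•(d − d′)`
  have hsplit : (WithLp.toLp 2 (v • dir s) : Momentum) - WithLp.toLp 2 (v' • dir s') =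
      WithLp.toLp 2 ((v - v') • dir s) + v' • ((WithLp.toLp 2 (dir s) : Momentum) - WithLp.toLp 2 (dir s')) := by
    rw [smul_sub, ← WithLp.toLp_smul, ← WithLp.toLp_smul, ← WithLp.toLp_sub, ← WithLp.toLp_sub, ← WithLp.toLp_add, sub_smul]
    congr 1
    abel
  rw [hsplit]
  calc ‖(WithLp.toLp 2 ((v - v') • dir s) : Momentum) + v' • ((WithLp.toLp 2 (dir s) : Momentum) - WithLp.toLp 2 (dir s'))‖
      ≤ ‖(WithLp.toLp 2 ((v - v') • dir s) : Momentum)‖ + ‖v' • ((WithLp.toLp 2 (dir s) : Momentum) - WithLp.toLp 2 (dir s'))‖ := norm_add_le _ _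
    _ ≤ (klJacG B.Dtmin A A₃ 1 / B.umin + π * Real.sqrt 2 / (B.Dtmin - 2 * A) * klJacR1 B.Dtmin A / B.umin ^ 2) * |s - s'| +
          (B.Dtmin - 2 * A)⁻¹ * |s - s'| := by
        refine add_le_add ?_ ?_
        · rw [norm_toLp_smul_dir]; exact hvv
        · rw [norm_smul, Real.norm_eq_abs]
          exact mul_le_mul hv'le (norm_toLp_dir_sub_le s s') (norm_nonneg _) (le_trans (abs_nonneg _) hv'le)
    _ = _ := by ring

end Level

/-! ## §3 The reflection defect about the Cooper angle and the reflection segment -/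

/-- The pair-sum path at relative angle `π + φ` is a DIFFERENCE of chart points: `S_{ρ,π+φ,θ}(0) = Φ(0,θ) − Φ(ρ,θ+φ)` (central symmetry). -/
theorem pairSumPath_pi_add_apply_zero (μ : ℝ) (K : TrigPolyC4v) (ρ φ θ : ℝ) :
    pairSumPath μ K ρ (π + φ) θ 0 = levelPoint μ K 0 θ - levelPoint μ K ρ (θ + φ) := by
  rw [pairSumPath_apply_zero, show π + φ + θ = (θ + φ) + π by ring, levelPoint_add_pi, sub_eq_add_neg]

/-- **The reflection defect, explicitly**: `S_{ρ,π+φ,θ}(0) + S_{ρ,π−φ,θ}(0) = 2Φ(0,θ) − Φ(ρ,θ+φ) − Φ(ρ,θ−φ)`. -/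
theorem pairSumPath_reflDefect_eq (μ : ℝ) (K : TrigPolyC4v) (ρ φ θ : ℝ) :
    pairSumPath μ K ρ (π + φ) θ 0 + pairSumPath μ K ρ (π - φ) θ 0 =
      (2 : ℝ) • levelPoint μ K 0 θ - levelPoint μ K ρ (θ + φ) - levelPoint μ K ρ (θ - φ) := by
  rw [pairSumPath_pi_add_apply_zero, show π - φ = π + (-φ) by ring, pairSumPath_pi_add_apply_zero,
    show θ + -φ = θ - φ by ring, two_smul]
  abel

section Sizes

variable {K : TrigPolyC4v} {A : ℝ} (hA : ∀ p : Momentum, ∀ j ≤ 2, ‖iteratedFDeriv ℝ j (frameShift K) p‖ ≤ A) (hA20 : A ≤ 1 / 20)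
  (hd : klCurveD ≤ (bandBounds (show (-4 : ℝ) < -1.1 by norm_num) (show (-1.1 : ℝ) ≤ -0.1 by norm_num)
    (show (-0.1 : ℝ) < 0 by norm_num)).Dtmin - 2 * A)
  {μ r : ℝ} (hr : 0 < r) (hlo : (-1.1 : ℝ) < μ - r - A) (hhi : μ + r + A < -0.1)
  {A₃ A₄ : ℝ} (hA₃ : ∀ p : Momentum, ‖iteratedFDeriv ℝ 3 (frameShift K) p‖ ≤ A₃)
  (hA₄ : ∀ p : Momentum, ‖iteratedFDeriv ℝ 4 (frameShift K) p‖ ≤ A₄)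
include hA hA20 hd hr hlo hhi hA₃ hA₄

/-- **Second symmetric difference of the Fermi curve**: `‖Φ(0,θ+φ) + Φ(0,θ−φ) − 2Φ(0,θ)‖ ≤ 2·msD A₃ A₄ 2·φ²`
(mean value on `t ↦ Φ(0,θ+t) + Φ(0,θ−t)`, whose derivative `γ₀′(θ+t) − γ₀′(θ−t)` is `≤ msD₂·2|t|` by the angular modulus of the curve jet). -/
theorem norm_levelPoint_symmDiff_le (θ φ : ℝ) :
    ‖levelPoint μ K 0 (θ + φ) + levelPoint μ K 0 (θ - φ) - (2 : ℝ) • levelPoint μ K 0 θ‖ ≤ 2 * msD A₃ A₄ 2 * φ ^ 2 := by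
  have h0 : |(0 : ℝ)| < r := by simpa using hr
  set γ : ℝ → Momentum := levelPoint μ K 0 with hγ
  have hC : ContDiff ℝ 2 γ := contDiff_levelPoint_of_sizes hA hd hlo hhi h0 2
  have hdiff : Differentiable ℝ γ := hC.differentiable (by norm_num)
  set g : ℝ → Momentum := fun t => γ (θ + t) + γ (θ - t) with hg
  have hgder : ∀ t, HasDerivAt g (deriv γ (θ + t) - deriv γ (θ - t)) t := fun t => by
    have h1 : HasDerivAt (fun t => γ (θ + t)) (deriv γ (θ + t)) t := by
      have := (hdiff (θ + t)).hasDerivAt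
      exact HasDerivAt.comp_const_add θ t this
    have h2 : HasDerivAt (fun t => γ (θ - t)) (-deriv γ (θ - t)) t :=
      HasDerivAt.comp_const_sub θ t (hdiff (θ - t)).hasDerivAt
    have h12 : HasDerivAt g (deriv γ (θ + t) + -deriv γ (θ - t)) t := h1.add h2
    exact h12.congr_deriv (by abel)
  -- derivative bound on the segment between `0` and `φ`
  have hbound : ∀ t ∈ Set.uIcc 0 φ, ‖deriv γ (θ + t) - deriv γ (θ - t)‖ ≤ 2 * msD A₃ A₄ 2 * |φ| := fun t ht => by
    have h := norm_iteratedDeriv_levelPoint_sub_le_angle hA hA20 hd hlo hhi hA₃ hA₄ h0 (i := 1) (by norm_num) (θ + t) (θ - t)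
    rw [iteratedDeriv_one, show θ + t - (θ - t) = 2 * t by ring, abs_mul, abs_two] at h
    have ht' : |t| ≤ |φ| := by
      rcases le_total 0 φ with hφ | hφ
      · rw [Set.uIcc_of_le hφ] at ht; rw [abs_of_nonneg ht.1, abs_of_nonneg hφ]; exact ht.2
      · rw [Set.uIcc_of_ge hφ] at ht; rw [abs_of_nonpos ht.2, abs_of_nonpos hφ]; linarith [ht.1]
    have hm : 0 ≤ msD A₃ A₄ 2 := le_trans (norm_nonneg _) (norm_iteratedDeriv_levelPoint_le hA hA20 hd hlo hhi hA₃ hA₄ h0 (i := 2)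
      (by norm_num) (by norm_num) θ)
    calc ‖deriv γ (θ + t) - deriv γ (θ - t)‖ ≤ msD A₃ A₄ 2 * (2 * |t|) := h
      _ ≤ msD A₃ A₄ 2 * (2 * |φ|) := by gcongr
      _ = 2 * msD A₃ A₄ 2 * |φ| := by ring
  have hMVT := Convex.norm_image_sub_le_of_norm_hasDerivWithin_le (f := g) (s := Set.uIcc 0 φ) (C := 2 * msD A₃ A₄ 2 * |φ|)
    (fun t _ => (hgder t).hasDerivWithinAt) hbound (convex_uIcc 0 φ) Set.left_mem_uIcc Set.right_mem_uIcc
  have hg0 : g 0 = (2 : ℝ) • γ θ := by simp [hg, two_smul]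
  have hgφ : g φ = γ (θ + φ) + γ (θ - φ) := rfl
  rw [hgφ, hg0, sub_zero] at hMVT
  calc ‖γ (θ + φ) + γ (θ - φ) - (2 : ℝ) • γ θ‖ ≤ 2 * msD A₃ A₄ 2 * |φ| * ‖φ‖ := hMVT
    _ = 2 * msD A₃ A₄ 2 * φ ^ 2 := by rw [Real.norm_eq_abs, mul_assoc, ← sq, sq_abs]

/-- **SIZE OF THE REFLECTION DEFECT**: for `|ρ| < r`,
`‖S_{ρ,π+φ,θ}(0) + S_{ρ,π−φ,θ}(0)‖ ≤ 2|ρ|/(Dt_min − 2A) + 2·msD A₃ A₄ 2·φ²` (two radial displacements and one second symmetric difference). -/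
theorem norm_pairSumPath_reflDefect_le {ρ : ℝ} (hρ : |ρ| < r) (φ θ : ℝ) :
    ‖pairSumPath μ K ρ (π + φ) θ 0 + pairSumPath μ K ρ (π - φ) θ 0‖ ≤
      2 * |ρ| / ((bandBounds (show (-4 : ℝ) < -1.1 by norm_num) (show (-1.1 : ℝ) ≤ -0.1 by norm_num) (show (-0.1 : ℝ) < 0 by norm_num)).Dtmin -
          2 * A) + 2 * msD A₃ A₄ 2 * φ ^ 2 := by
  set B := bandBounds (show (-4 : ℝ) < -1.1 by norm_num) (show (-1.1 : ℝ) ≤ -0.1 by norm_num) (show (-0.1 : ℝ) < 0 by norm_num) with hBdef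
  have hADt : 2 * A < B.Dtmin := by have := klCurveD_pos; linarith
  have hρI : ρ ∈ Ioo (-r) r := ⟨(abs_lt.1 hρ).1, (abs_lt.1 hρ).2⟩
  have h0I : (0 : ℝ) ∈ Ioo (-r) r := ⟨by linarith, hr⟩
  have hN : ∀ s, ‖levelPoint μ K ρ s - levelPoint μ K 0 s‖ ≤ |ρ| / (B.Dtmin - 2 * A) := fun s => by
    simpa using norm_levelPoint_sub_levelPoint_le B hA hADt hlo hhi hρI h0I s
  have hT := norm_levelPoint_symmDiff_le hA hA20 hd hr hlo hhi hA₃ hA₄ θ φ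
  rw [pairSumPath_reflDefect_eq]
  have hid : (2 : ℝ) • levelPoint μ K 0 θ - levelPoint μ K ρ (θ + φ) - levelPoint μ K ρ (θ - φ) =
      -((levelPoint μ K ρ (θ + φ) - levelPoint μ K 0 (θ + φ)) + (levelPoint μ K ρ (θ - φ) - levelPoint μ K 0 (θ - φ)) +
        (levelPoint μ K 0 (θ + φ) + levelPoint μ K 0 (θ - φ) - (2 : ℝ) • levelPoint μ K 0 θ)) := by abel
  rw [hid, norm_neg]
  calc _ ≤ ‖(levelPoint μ K ρ (θ + φ) - levelPoint μ K 0 (θ + φ)) + (levelPoint μ K ρ (θ - φ) - levelPoint μ K 0 (θ - φ))‖ +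
        ‖levelPoint μ K 0 (θ + φ) + levelPoint μ K 0 (θ - φ) - (2 : ℝ) • levelPoint μ K 0 θ‖ := norm_add_le _ _
    _ ≤ (|ρ| / (B.Dtmin - 2 * A) + |ρ| / (B.Dtmin - 2 * A)) + 2 * msD A₃ A₄ 2 * φ ^ 2 :=
        add_le_add ((norm_add_le _ _).trans (add_le_add (hN _) (hN _))) hT
    _ = _ := by ring

/-- **THE REFLECTION SEGMENT STAYS AWAY FROM THE COOPER POINT.**  For `|ρ| < r`, `|φ| ≤ π` and `t ∈ [0,1]`,
`pairSumLowerConst r·|φ| − 3|ρ|/(Dt_min − 2A) − 2·msD A₃ A₄ 2·φ² ≤ ‖S_{ρ,π+φ,θ}(0) − t·(S_{ρ,π+φ,θ}(0) + S_{ρ,π−φ,θ}(0))‖`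
(transversality of the chart at `ρ = 0`, `…C4aPathComparability.norm_pairSumPath_zero_ge`, one radial displacement and the defect).  On the window
`κ₀|ρ| ≤ |φ| ≤ φ₀` with `κ₀ = 12/(c·(Dt_min−2A))`, `φ₀ = c/(8·msD₂)` (`c = pairSumLowerConst r`) the right-hand side is `≥ (c/2)·|φ|`. -/
theorem norm_pairSumPath_sub_smul_reflDefect_ge {ρ : ℝ} (hρ : |ρ| < r) {φ : ℝ} (hφ : |φ| ≤ π) (θ : ℝ) {t : ℝ} (ht : t ∈ Icc (0 : ℝ) 1) :
    pairSumLowerConst r * |φ| -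
        3 * |ρ| / ((bandBounds (show (-4 : ℝ) < -1.1 by norm_num) (show (-1.1 : ℝ) ≤ -0.1 by norm_num) (show (-0.1 : ℝ) < 0 by norm_num)).Dtmin -
          2 * A) - 2 * msD A₃ A₄ 2 * φ ^ 2 ≤
      ‖pairSumPath μ K ρ (π + φ) θ 0 - t • (pairSumPath μ K ρ (π + φ) θ 0 + pairSumPath μ K ρ (π - φ) θ 0)‖ := by
  set B := bandBounds (show (-4 : ℝ) < -1.1 by norm_num) (show (-1.1 : ℝ) ≤ -0.1 by norm_num) (show (-0.1 : ℝ) < 0 by norm_num) with hBdef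
  have hADt : 2 * A < B.Dtmin := by have := klCurveD_pos; linarith
  have hρI : ρ ∈ Ioo (-r) r := ⟨(abs_lt.1 hρ).1, (abs_lt.1 hρ).2⟩
  have h0I : (0 : ℝ) ∈ Ioo (-r) r := ⟨by linarith, hr⟩
  have h0 : |(0 : ℝ)| < r := by simpa using hr
  set S := pairSumPath μ K ρ (π + φ) θ 0 with hS
  set S₀ := pairSumPath μ K 0 (π + φ) θ 0 with hS₀
  set Δ := pairSumPath μ K ρ (π + φ) θ 0 + pairSumPath μ K ρ (π - φ) θ 0 with hΔ
  -- transversality at `ρ = 0`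
  have hϑ : π + φ ∈ Icc 0 (2 * π) := ⟨by linarith [(abs_le.1 hφ).1], by linarith [(abs_le.1 hφ).2]⟩
  have hlow : pairSumLowerConst r * |φ| ≤ ‖S₀‖ := by
    have h := norm_pairSumPath_zero_ge hA hA20 hd hr hlo hhi hA₃ hA₄ h0 hϑ θ
    rwa [abs_zero, zero_add, show π + φ - π = φ by ring] at h
  -- one radial displacement
  have hdisp : ‖S - S₀‖ ≤ |ρ| / (B.Dtmin - 2 * A) := by
    rw [hS, hS₀, pairSumPath_apply_zero, pairSumPath_apply_zero, add_sub_add_left_eq_sub]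
    simpa using norm_levelPoint_sub_levelPoint_le B hA hADt hlo hhi hρI h0I (π + φ + θ)
  have hdef : ‖Δ‖ ≤ 2 * |ρ| / (B.Dtmin - 2 * A) + 2 * msD A₃ A₄ 2 * φ ^ 2 := norm_pairSumPath_reflDefect_le hA hA20 hd hr hlo hhi hA₃ hA₄ hρ φ θ
  have htΔ : ‖t • Δ‖ ≤ 2 * |ρ| / (B.Dtmin - 2 * A) + 2 * msD A₃ A₄ 2 * φ ^ 2 := by
    rw [norm_smul, Real.norm_eq_abs, abs_of_nonneg ht.1]
    calc t * ‖Δ‖ ≤ 1 * ‖Δ‖ := mul_le_mul_of_nonneg_right ht.2 (norm_nonneg _)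
      _ ≤ _ := by rw [one_mul]; exact hdef
  -- `‖S − tΔ‖ ≥ ‖S₀‖ − ‖S − S₀‖ − ‖tΔ‖`
  have htri : ‖S₀‖ ≤ ‖S - t • Δ‖ + ‖S - S₀‖ + ‖t • Δ‖ := by
    have h1 : S₀ = (S - t • Δ) - (S - S₀) + t • Δ := by abel
    calc ‖S₀‖ = ‖(S - t • Δ) - (S - S₀) + t • Δ‖ := by rw [← h1]
      _ ≤ ‖(S - t • Δ) - (S - S₀)‖ + ‖t • Δ‖ := norm_add_le _ _
      _ ≤ ‖S - t • Δ‖ + ‖S - S₀‖ + ‖t • Δ‖ := by gcongr; exact norm_sub_le _ _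
  have h3 : 3 * |ρ| / (B.Dtmin - 2 * A) = |ρ| / (B.Dtmin - 2 * A) + 2 * |ρ| / (B.Dtmin - 2 * A) := by ring
  linarith

end Sizes

end Summit.HubbardSuperconductivity.HubbardSuperconductivity.Theorems.C4a

end
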